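import Mathlib.Data.Fintype.Prod
import Mathlib.Algebra.BigOperators.Group.Finset.Basic
import Mathlib.Data.Finset.Max
import Mathlib.Data.Finset.Powerset
import Literature.Combinatorics.SimpleGraph.RemovableArc
import HarnessLib

/-!
# A 2-diregular digraph with all arcs removable has a digon or a non-cut vertex

Topic `Combinatorics/SimpleGraph`; theorems only. A digraph lemma for the finish of the hard
direction of Little's theorem (`Little1975_isPfaffianBipartite_iff_not_isMatchingMinor`,
`LittleTheorem.lean`), in the vocabulary of `MatchingDigraph.lean` (`IsArc G`, `IsStrong G` for
`G ⊆ Fin n × Fin n`): the digraph `D(G, M)` of a minimal non-Pfaffian bipartite graph is strongly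
connected, every vertex has exactly two out-arcs and two in-arcs, and every arc is removable
(`LittleCoreDegrees.lean`). For such digraphs:

* `two_le_card_inArcs` — every non-empty proper vertex set is entered by at least two arcs (one by
  strong connectivity, a second one because the first is removable);
* `card_outArcs_eq_card_inArcs` — and is left by as many arcs as enter it (degree balance);
* `exists_digon_or_nonCutVertex` — **either `D` has a directed 2-circuit, or some vertex `y` is not
  a cut vertex: `D − y` is strongly connected.** Proof: let `Z` be a smallest vertex set with
  `2 ≤ |Z| < n` entered by exactly two arcs, `w₁, w₂` the tails of the two arcs leaving it. If
  `Z = {w₁, w₂}` with `w₁ ≠ w₂`, the second out-arcs of `w₁, w₂` form a digon. Otherwise pick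
  `y ∈ Z ∖ {w₁, w₂}`; if `D − y` were not strongly connected, the set `Q` of vertices reaching some
  `b` in `D − y` misses some `a`, is entered only from `y`, hence by both out-arcs of `y`, which
  lie in `Z`; uncrossing `Q` with `Z` (submodularity of in-degrees) produces a smaller such set —
  `Q ∩ Z` if `Q ∪ Z ≠ V`, else `V ∖ Q ⊊ Z` (or `V ∖ Q = Z`, which would force `y ∈ {w₁, w₂}`).
  This replaces, in our setting, Seymour–Thomassen's step (2) ("`D` is strongly 2-connected",
  proved there via minimality under containment of weak double cycles).

## References

* P. D. Seymour, C. Thomassen, *Characterization of even directed graphs*, J. Combin. Theory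
  Ser. B 42 (1987) 36–45, §4 (2). [SeymourThomassen1987]
* C. H. C. Little, *A characterization of convertible (0,1)-matrices*, J. Combin. Theory Ser. B
  18 (1975) 187–208, §4. [Little1975]
-/

namespace Literature.Combinatorics.SimpleGraph

open Finset

variable {n : ℕ} {G : Finset (Fin n × Fin n)}

/-! ### Entering and leaving arcs of a vertex set -/

/-- A chain from outside `X` to inside `X` uses an arc entering `X`. [folklore] -/
theorem exists_inArc_of_isChain {G' : Finset (Fin n × Fin n)} {X : Finset (Fin n)} {a : Fin n}
    {l : List (Fin n)} (hc : (a :: l).IsChain (IsArc G')) (ha : a ∉ X)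
    (hb : (a :: l).getLast (List.cons_ne_nil _ _) ∈ X) :
    ∃ e : Fin n × Fin n, IsArc G' e.1 e.2 ∧ e.1 ∉ X ∧ e.2 ∈ X := by
  classical
  obtain ⟨i, hi, h1, h2⟩ := exists_succ_mem_not_mem ({v | v ∉ X} : Set (Fin n)) (a :: l)
    (List.cons_ne_nil _ _) (by simpa using ha) (by simpa using hb)
  simp only [Set.mem_setOf_eq, not_not] at h1 h2
  exact ⟨((a :: l)[i], (a :: l)[i + 1]), List.isChain_iff_getElem.1 hc i hi, h1, h2⟩

/-- **Every non-empty proper vertex set is entered by at least two arcs** when `D(G, M)` is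
strongly connected and stays so after deleting any single arc. [folklore] -/
theorem two_le_card_inArcs (hs : IsStrong G) (hrem : ∀ a b, IsArc G a b → IsStrong (G.erase (a, b)))
    {X : Finset (Fin n)} (hne : X.Nonempty) (hX : X ≠ Finset.univ) :
    2 ≤ (Finset.univ.filter fun e : Fin n × Fin n => IsArc G e.1 e.2 ∧ e.1 ∉ X ∧ e.2 ∈ X).card := by
  classical
  obtain ⟨b, hb⟩ := hne
  obtain ⟨a, ha⟩ : ∃ a, a ∉ X := by
    by_contra h
    exact hX (Finset.eq_univ_iff_forall.2 fun a => not_not.1 fun ha => h ⟨a, ha⟩)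
  -- a first entering arc, by strong connectivity
  obtain ⟨l, hc, -, hlast⟩ := hs.exists_path a b
  obtain ⟨e, he, he1, he2⟩ := exists_inArc_of_isChain hc ha (by rw [hlast]; exact hb)
  -- a second one, since `e` is removable
  obtain ⟨l', hc', -, hlast'⟩ := (hrem e.1 e.2 he).exists_path e.1 e.2
  obtain ⟨f, hf, hf1, hf2⟩ := exists_inArc_of_isChain hc' he1 (by rw [hlast']; exact he2)
  rw [isArc_erase_iff] at hf
  refine Finset.one_lt_card.2 ⟨e, ?_, f, ?_, fun hef => hf.2 ?_⟩
  · exact Finset.mem_filter.2 ⟨Finset.mem_univ _, he, he1, he2⟩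
  · exact Finset.mem_filter.2 ⟨Finset.mem_univ _, hf.1, hf1, hf2⟩
  · rw [← hef]

/-- The number of arcs with tail in `X` is twice `|X|` when every vertex has two out-arcs.
[folklore] -/
theorem card_filter_fst_mem (hout : ∀ x, (Finset.univ.filter fun y => IsArc G x y).card = 2)
    (X : Finset (Fin n)) :
    (Finset.univ.filter fun e : Fin n × Fin n => IsArc G e.1 e.2 ∧ e.1 ∈ X).card = 2 * X.card := by
  classical
  have h : (Finset.univ.filter fun e : Fin n × Fin n => IsArc G e.1 e.2 ∧ e.1 ∈ X) =
      X.biUnion fun x => (Finset.univ.filter fun y => IsArc G x y).map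
        ⟨fun y => (x, y), fun y y' h => (Prod.ext_iff.1 h).2⟩ := by
    ext e
    simp only [Finset.mem_filter, Finset.mem_univ, true_and, Finset.mem_biUnion, Finset.mem_map,
      Function.Embedding.coeFn_mk]
    constructor
    · rintro ⟨h1, h2⟩
      exact ⟨e.1, h2, e.2, h1, rfl⟩
    · rintro ⟨x, hx, y, hy, rfl⟩
      exact ⟨hy, hx⟩
  rw [h, Finset.card_biUnion]
  · rw [Finset.sum_const_nat (m := 2) fun x _ => by rw [Finset.card_map, hout], mul_comm]
  · intro x _ x' _ hxx'
    rw [Function.onFun, Finset.disjoint_left]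
    intro e he he'
    obtain ⟨y, -, rfl⟩ := Finset.mem_map.1 he
    obtain ⟨y', -, h'⟩ := Finset.mem_map.1 he'
    exact hxx' (Prod.ext_iff.1 h').1.symm

/-- The number of arcs with head in `X` is twice `|X|` when every vertex has two in-arcs.
[folklore] -/
theorem card_filter_snd_mem (hin : ∀ y, (Finset.univ.filter fun x => IsArc G x y).card = 2)
    (X : Finset (Fin n)) :
    (Finset.univ.filter fun e : Fin n × Fin n => IsArc G e.1 e.2 ∧ e.2 ∈ X).card = 2 * X.card := by
  classical
  have h : (Finset.univ.filter fun e : Fin n × Fin n => IsArc G e.1 e.2 ∧ e.2 ∈ X) =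
      X.biUnion fun y => (Finset.univ.filter fun x => IsArc G x y).map
        ⟨fun x => (x, y), fun x x' h => (Prod.ext_iff.1 h).1⟩ := by
    ext e
    simp only [Finset.mem_filter, Finset.mem_univ, true_and, Finset.mem_biUnion, Finset.mem_map,
      Function.Embedding.coeFn_mk]
    constructor
    · rintro ⟨h1, h2⟩
      exact ⟨e.2, h2, e.1, h1, rfl⟩
    · rintro ⟨y, hy, x, hx, rfl⟩
      exact ⟨hx, hy⟩
  rw [h, Finset.card_biUnion]
  · rw [Finset.sum_const_nat (m := 2) fun y _ => by rw [Finset.card_map, hin], mul_comm]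
  · intro y _ y' _ hyy'
    rw [Function.onFun, Finset.disjoint_left]
    intro e he he'
    obtain ⟨x, -, rfl⟩ := Finset.mem_map.1 he
    obtain ⟨x', -, h'⟩ := Finset.mem_map.1 he'
    exact hyy' (Prod.ext_iff.1 h').2.symm

/-- **Degree balance: as many arcs leave a vertex set as enter it** (every vertex has two out-arcs
and two in-arcs). [folklore] -/
theorem card_outArcs_eq_card_inArcs (hout : ∀ x, (Finset.univ.filter fun y => IsArc G x y).card = 2)
    (hin : ∀ y, (Finset.univ.filter fun x => IsArc G x y).card = 2) (X : Finset (Fin n)) :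
    (Finset.univ.filter fun e : Fin n × Fin n => IsArc G e.1 e.2 ∧ e.1 ∈ X ∧ e.2 ∉ X).card =
      (Finset.univ.filter fun e : Fin n × Fin n => IsArc G e.1 e.2 ∧ e.1 ∉ X ∧ e.2 ∈ X).card := by
  classical
  have hT := card_filter_fst_mem hout X
  have hH := card_filter_snd_mem hin X
  -- split both by whether the other end lies in `X`
  have hT' := Finset.card_filter_add_card_filter_not
    (s := Finset.univ.filter fun e : Fin n × Fin n => IsArc G e.1 e.2 ∧ e.1 ∈ X)
    (fun e : Fin n × Fin n => e.2 ∈ X)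
  have hH' := Finset.card_filter_add_card_filter_not
    (s := Finset.univ.filter fun e : Fin n × Fin n => IsArc G e.1 e.2 ∧ e.2 ∈ X)
    (fun e : Fin n × Fin n => e.1 ∈ X)
  simp only [Finset.filter_filter] at hT' hH'
  have h1 : (Finset.univ.filter fun e : Fin n × Fin n => (IsArc G e.1 e.2 ∧ e.1 ∈ X) ∧ e.2 ∈ X) =
      Finset.univ.filter fun e : Fin n × Fin n => (IsArc G e.1 e.2 ∧ e.2 ∈ X) ∧ e.1 ∈ X := by
    ext e; simp only [Finset.mem_filter, Finset.mem_univ, true_and]; tauto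
  have h2 : (Finset.univ.filter fun e : Fin n × Fin n => (IsArc G e.1 e.2 ∧ e.1 ∈ X) ∧ ¬ e.2 ∈ X) =
      Finset.univ.filter fun e : Fin n × Fin n => IsArc G e.1 e.2 ∧ e.1 ∈ X ∧ e.2 ∉ X := by
    ext e; simp only [Finset.mem_filter, Finset.mem_univ, true_and]; tauto
  have h3 : (Finset.univ.filter fun e : Fin n × Fin n => (IsArc G e.1 e.2 ∧ e.2 ∈ X) ∧ ¬ e.1 ∈ X) =
      Finset.univ.filter fun e : Fin n × Fin n => IsArc G e.1 e.2 ∧ e.1 ∉ X ∧ e.2 ∈ X := by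
    ext e; simp only [Finset.mem_filter, Finset.mem_univ, true_and]; tauto
  rw [h1, h2] at hT'
  rw [h3] at hH'
  omega

/-! ### The non-cut vertex -/

/-- **A strongly connected digraph in which every vertex has two out-arcs and two in-arcs and every
arc is removable has a directed 2-circuit or a vertex whose deletion keeps it strongly connected**
(here: every two vertices other than `y` are joined by a directed path avoiding `y`).
[cite: SeymourThomassen1987, §4 (2)] -/
theorem exists_digon_or_nonCutVertex (hs : IsStrong G)
    (hrem : ∀ a b, IsArc G a b → IsStrong (G.erase (a, b)))
    (hout : ∀ x, (Finset.univ.filter fun y => IsArc G x y).card = 2)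
    (hin : ∀ y, (Finset.univ.filter fun x => IsArc G x y).card = 2) (hn : 3 ≤ n) :
    (∃ u v, IsArc G u v ∧ IsArc G v u) ∨
      ∃ y : Fin n, ∀ a b, a ≠ y → b ≠ y →
        Relation.ReflTransGen (fun c d => IsArc G c d ∧ c ≠ y ∧ d ≠ y) a b := by
  classical
  -- entering / leaving arcs of a vertex set
  set inA : Finset (Fin n) → Finset (Fin n × Fin n) := fun X =>
    Finset.univ.filter fun e : Fin n × Fin n => IsArc G e.1 e.2 ∧ e.1 ∉ X ∧ e.2 ∈ X with hinA
  set outA : Finset (Fin n) → Finset (Fin n × Fin n) := fun X =>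
    Finset.univ.filter fun e : Fin n × Fin n => IsArc G e.1 e.2 ∧ e.1 ∈ X ∧ e.2 ∉ X with houtA
  have hmem_in : ∀ X e, e ∈ inA X ↔ IsArc G e.1 e.2 ∧ e.1 ∉ X ∧ e.2 ∈ X := fun X e => by
    simp [hinA]
  have hmem_out : ∀ X e, e ∈ outA X ↔ IsArc G e.1 e.2 ∧ e.1 ∈ X ∧ e.2 ∉ X := fun X e => by
    simp [houtA]
  have htwo : ∀ X : Finset (Fin n), X.Nonempty → X ≠ Finset.univ → 2 ≤ (inA X).card :=
    fun X hne hX => two_le_card_inArcs hs hrem hne hX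
  have hbal : ∀ X : Finset (Fin n), (outA X).card = (inA X).card := fun X =>
    card_outArcs_eq_card_inArcs hout hin X
  -- the out-arcs of a vertex, as pairs
  have hout_pairs : ∀ y : Fin n,
      ((Finset.univ.filter fun c => IsArc G y c).map ⟨fun c => (y, c), fun c c' h =>
        (Prod.ext_iff.1 h).2⟩).card = 2 := fun y => by rw [Finset.card_map, hout]
  -- the family of candidate sets and a smallest member
  set fam : Finset (Finset (Fin n)) := (Finset.univ : Finset (Fin n)).powerset.filter fun X =>
    2 ≤ X.card ∧ X ≠ Finset.univ ∧ (inA X).card = 2 with hfam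
  have hfam_mem : ∀ X, X ∈ fam ↔ 2 ≤ X.card ∧ X ≠ Finset.univ ∧ (inA X).card = 2 := fun X => by
    simp only [hfam, Finset.mem_filter, Finset.mem_powerset, Finset.subset_univ, true_and]
  obtain ⟨v₀⟩ : Nonempty (Fin n) := ⟨⟨0, by omega⟩⟩
  have hfam_ne : fam.Nonempty := by
    refine ⟨Finset.univ.erase v₀, (hfam_mem _).2 ⟨?_, ?_, ?_⟩⟩
    · rw [Finset.card_erase_of_mem (Finset.mem_univ _), Finset.card_univ, Fintype.card_fin]; omega
    · intro h
      have := Finset.ext_iff.1 h v₀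
      simp at this
    · have h : inA (Finset.univ.erase v₀) =
          (Finset.univ.filter fun c => IsArc G v₀ c).map ⟨fun c => (v₀, c), fun c c' h =>
            (Prod.ext_iff.1 h).2⟩ := by
        ext e
        rw [hmem_in]
        simp only [Finset.mem_erase, ne_eq, Finset.mem_univ, and_true, not_not, Finset.mem_map,
          Finset.mem_filter, true_and, Function.Embedding.coeFn_mk]
        constructor
        · rintro ⟨harc, h1, -⟩
          exact ⟨e.2, by rw [← h1]; exact harc, by rw [← h1]⟩
        · rintro ⟨c, hc, rfl⟩
          exact ⟨hc, rfl, fun h => hc.1 h.symm⟩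
      rw [h]
      exact hout_pairs v₀
  obtain ⟨Z, hZfam, hZmin⟩ := Finset.exists_min_image fam Finset.card hfam_ne
  obtain ⟨hZ2, hZuniv, hZin⟩ := (hfam_mem Z).1 hZfam
  -- the two leaving arcs of `Z`
  have hZout : (outA Z).card = 2 := by rw [hbal, hZin]
  obtain ⟨e₁, e₂, hne12, hout12⟩ := Finset.card_eq_two.1 hZout
  have he₁ : e₁ ∈ outA Z := by rw [hout12]; simp
  have he₂ : e₂ ∈ outA Z := by rw [hout12]; simp
  rw [hmem_out] at he₁ he₂
  -- an out-arc of a vertex of `Z` other than the tails `e₁.1, e₂.1` stays in `Z`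
  have hstay : ∀ y c, y ∈ Z → y ≠ e₁.1 → y ≠ e₂.1 → IsArc G y c → c ∈ Z := by
    intro y c hy hy1 hy2 hyc
    by_contra hc
    have : (y, c) ∈ outA Z := (hmem_out Z (y, c)).2 ⟨hyc, hy, hc⟩
    rw [hout12, Finset.mem_insert, Finset.mem_singleton] at this
    rcases this with h | h
    · exact hy1 (by rw [← h])
    · exact hy2 (by rw [← h])
  by_cases hsmall : Z.card = 2 ∧ e₁.1 ≠ e₂.1
  · -- `Z = {w₁, w₂}`: a digon
    left
    obtain ⟨hcard, hw⟩ := hsmall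
    have hZeq : Z = {e₁.1, e₂.1} := by
      symm
      apply Finset.eq_of_subset_of_card_le
      · intro w hw'
        simp only [Finset.mem_insert, Finset.mem_singleton] at hw'
        rcases hw' with rfl | rfl
        exacts [he₁.2.1, he₂.2.1]
      · rw [hcard, Finset.card_pair hw]
    -- the second out-arc of `e₁.1` goes to `e₂.1`, and conversely
    have hsecond : ∀ (e f : Fin n × Fin n), IsArc G e.1 e.2 ∧ e.1 ∈ Z ∧ e.2 ∉ Z →
        IsArc G f.1 f.2 ∧ f.1 ∈ Z ∧ f.2 ∉ Z → e ≠ f → e.1 ≠ f.1 → Z = {e.1, f.1} → IsArc G e.1 f.1 := by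
      intro e f he hf hef hef1 hZ
      -- out-arcs of `e.1`: exactly two, one of them is `e`
      obtain ⟨c₁, c₂, hc, hcs⟩ := Finset.card_eq_two.1 (hout e.1)
      have hmemc : ∀ c, IsArc G e.1 c ↔ c = c₁ ∨ c = c₂ := fun c => by
        have := Finset.ext_iff.1 hcs c
        simpa using this
      -- any out-arc of `e.1` leaving `Z` is `e`
      have hleave : ∀ c, IsArc G e.1 c → c ∉ Z → c = e.2 := by
        intro c hc' hcZ
        have hmem : (e.1, c) ∈ outA Z := (hmem_out Z _).2 ⟨hc', he.2.1, hcZ⟩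
        rw [hout12, Finset.mem_insert, Finset.mem_singleton] at hmem
        have he' : e ∈ outA Z := (hmem_out Z e).2 he
        rw [hout12, Finset.mem_insert, Finset.mem_singleton] at he'
        have hf' : f ∈ outA Z := (hmem_out Z f).2 hf
        rw [hout12, Finset.mem_insert, Finset.mem_singleton] at hf'
        -- `(e.1, c)` is `e₁` or `e₂`; it is not `f` (different tail), hence it is `e`
        have hcf : (e.1, c) ≠ f := fun h => hef1 (by rw [← h])
        rcases hmem with h | h <;> rcases he' with h' | h' <;> rcases hf' with h'' | h''
        all_goals first
          | exact absurd (h'.trans h''.symm) hef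
          | exact (Prod.ext_iff.1 (h.trans h'.symm)).2
          | exact absurd (h.trans h''.symm) hcf
      -- the other out-neighbour lies in `Z = {e.1, f.1}` and is not `e.1`
      obtain ⟨c, hcarc, hcne⟩ : ∃ c, IsArc G e.1 c ∧ c ≠ e.2 := by
        by_cases h1 : c₁ = e.2
        · refine ⟨c₂, (hmemc c₂).2 (Or.inr rfl), fun h2 => hc (h1.trans h2.symm)⟩
        · exact ⟨c₁, (hmemc c₁).2 (Or.inl rfl), h1⟩
      have hcZ : c ∈ Z := by
        by_contra hcZ
        exact hcne (hleave c hcarc hcZ)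
      rw [hZ, Finset.mem_insert, Finset.mem_singleton] at hcZ
      rcases hcZ with h | h
      · exact absurd h.symm hcarc.1
      · rw [← h]; exact hcarc
    refine ⟨e₁.1, e₂.1, hsecond e₁ e₂ he₁ he₂ hne12 hw hZeq, hsecond e₂ e₁ he₂ he₁ hne12.symm hw.symm ?_⟩
    rw [hZeq, Finset.pair_comm]
  · -- a vertex `y ∈ Z` other than the two tails is not a cut vertex
    right
    obtain ⟨y, hyZ, hy1, hy2⟩ : ∃ y ∈ Z, y ≠ e₁.1 ∧ y ≠ e₂.1 := by
      by_cases hw : e₁.1 = e₂.1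
      · -- `|Z| ≥ 2`: some element differs from `e₁.1`
        obtain ⟨y, hy, hne⟩ := Finset.exists_mem_ne hZ2 e₁.1
        exact ⟨y, hy, hne, by rw [← hw]; exact hne⟩
      · have h3 : 3 ≤ Z.card := by
          by_contra h
          exact hsmall ⟨by omega, hw⟩
        obtain ⟨y, hy, hne⟩ := Finset.exists_mem_ne
          (show 1 < (Z.erase e₁.1).card by
            have := Finset.card_erase_le (s := Z) (a := e₁.1)
            have := Finset.pred_card_le_card_erase (s := Z) (a := e₁.1)
            omega) e₂.1
        exact ⟨y, Finset.mem_of_mem_erase hy, Finset.ne_of_mem_erase hy, hne⟩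
    refine ⟨y, fun a b ha hb => ?_⟩
    by_contra hpath
    -- `Q`: the vertices reaching `b` in `D − y`
    set Q : Finset (Fin n) := Finset.univ.filter fun v =>
      v ≠ y ∧ Relation.ReflTransGen (fun c d => IsArc G c d ∧ c ≠ y ∧ d ≠ y) v b with hQ
    have hQmem : ∀ v, v ∈ Q ↔ v ≠ y ∧
        Relation.ReflTransGen (fun c d => IsArc G c d ∧ c ≠ y ∧ d ≠ y) v b := fun v => by simp [hQ]
    have hbQ : b ∈ Q := (hQmem b).2 ⟨hb, Relation.ReflTransGen.refl⟩
    have haQ : a ∉ Q := fun h => hpath ((hQmem a).1 h).2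
    have hyQ : y ∉ Q := fun h => ((hQmem y).1 h).1 rfl
    have hQcl : ∀ c v, v ∈ Q → IsArc G c v → c ≠ y → c ∈ Q := by
      intro c v hv hcv hc
      obtain ⟨hvy, hvb⟩ := (hQmem v).1 hv
      exact (hQmem c).2 ⟨hc, Relation.ReflTransGen.head ⟨hcv, hc, hvy⟩ hvb⟩
    -- arcs entering `Q` leave `y`; there are two of them, so both out-arcs of `y` enter `Q`
    have hin_tail : ∀ e ∈ inA Q, e.1 = y := by
      intro e he
      obtain ⟨harc, h1, h2⟩ := (hmem_in Q e).1 he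
      by_contra hne
      exact h1 (hQcl e.1 e.2 h2 harc hne)
    have hsub : inA Q ⊆ (Finset.univ.filter fun c => IsArc G y c).map
        ⟨fun c => (y, c), fun c c' h => (Prod.ext_iff.1 h).2⟩ := by
      intro e he
      have hey := hin_tail e he
      obtain ⟨harc, -, -⟩ := (hmem_in Q e).1 he
      refine Finset.mem_map.2 ⟨e.2, Finset.mem_filter.2 ⟨Finset.mem_univ _, ?_⟩, ?_⟩
      · rw [← hey]; exact harc
      · simp only [Function.Embedding.coeFn_mk]; rw [← hey]
    have hQin : inA Q = (Finset.univ.filter fun c => IsArc G y c).map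
        ⟨fun c => (y, c), fun c c' h => (Prod.ext_iff.1 h).2⟩ :=
      Finset.eq_of_subset_of_card_le hsub (by
        rw [hout_pairs]
        exact htwo Q ⟨b, hbQ⟩ fun h => haQ (h ▸ Finset.mem_univ a))
    have hQin2 : (inA Q).card = 2 := by rw [hQin]; exact hout_pairs y
    have hyout : ∀ c, IsArc G y c → c ∈ Q := by
      intro c hc
      have : (y, c) ∈ inA Q := by
        rw [hQin]
        exact Finset.mem_map.2 ⟨c, Finset.mem_filter.2 ⟨Finset.mem_univ _, hc⟩, rfl⟩
      exact ((hmem_in Q _).1 this).2.2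
    -- both out-arcs of `y` stay in `Z`, so `|Q ∩ Z| ≥ 2`
    have hyoutZ : ∀ c, IsArc G y c → c ∈ Q ∩ Z := fun c hc =>
      Finset.mem_inter.2 ⟨hyout c hc, hstay y c hyZ hy1 hy2 hc⟩
    have hQZ2 : 2 ≤ (Q ∩ Z).card := by
      rw [← hout y]
      exact Finset.card_le_card fun c hc => hyoutZ c (Finset.mem_filter.1 hc).2
    have hQZne : (Q ∩ Z).Nonempty := Finset.card_pos.1 (by omega)
    by_cases hunion : Q ∪ Z = Finset.univ
    · -- `R := V ∖ Q ⊆ Z` is a candidate set, hence equal to `Z`; then `y` is a tail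
      set R : Finset (Fin n) := Finset.univ.filter fun v => v ∉ Q with hR
      have hRmem : ∀ v, v ∈ R ↔ v ∉ Q := fun v => by simp [hR]
      have hRZ : R ⊆ Z := by
        intro v hv
        have : v ∈ Q ∪ Z := hunion ▸ Finset.mem_univ v
        rcases Finset.mem_union.1 this with h | h
        · exact absurd h ((hRmem v).1 hv)
        · exact h
      have hRin : inA R = outA Q := by
        ext e
        rw [hmem_in, hmem_out, hRmem, hRmem, not_not]
      have hRfam : R ∈ fam := by
        refine (hfam_mem R).2 ⟨?_, ?_, ?_⟩
        · have hyR : y ∈ R := (hRmem y).2 hyQ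
          have haR : a ∈ R := (hRmem a).2 haQ
          exact Finset.one_lt_card.2 ⟨y, hyR, a, haR, ha.symm⟩
        · intro h
          have : b ∈ R := h ▸ Finset.mem_univ b
          exact (hRmem b).1 this hbQ
        · rw [hRin, hbal, hQin2]
      have hRZeq : R = Z := Finset.eq_of_subset_of_card_le hRZ (hZmin R hRfam)
      -- the leaving arc `e₁` of `Z = R` enters `Q`, so its tail is `y`
      have he₁in : e₁ ∈ inA Q := by
        refine (hmem_in Q e₁).2 ⟨he₁.1, ?_, ?_⟩
        · have : e₁.1 ∈ R := hRZeq ▸ he₁.2.1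
          exact (hRmem _).1 this
        · have : e₁.2 ∈ Q ∪ Z := hunion ▸ Finset.mem_univ _
          rcases Finset.mem_union.1 this with h | h
          · exact h
          · exact absurd h he₁.2.2
      exact hy1 (hin_tail e₁ he₁in).symm
    · -- `Q ∩ Z ⊊ Z` is a smaller candidate set
      have hunion_ne : (Q ∪ Z) ≠ Finset.univ := hunion
      -- no arc entering `Z` has its tail in `Q`
      have htailZ : ∀ e ∈ inA Z, e.1 ∉ Q := by
        intro e he heQ
        obtain ⟨harc, h1, h2⟩ := (hmem_in Z e).1 he
        -- otherwise `Q ∪ Z` is entered by at most one arc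
        have hsub' : inA (Q ∪ Z) ⊆ (inA Z).erase e := by
          intro f hf
          obtain ⟨hfarc, hf1, hf2⟩ := (hmem_in (Q ∪ Z) f).1 hf
          rw [Finset.mem_union, not_or] at hf1
          refine Finset.mem_erase.2 ⟨fun hfe => hf1.1 (hfe ▸ heQ), (hmem_in Z f).2 ⟨hfarc, hf1.2, ?_⟩⟩
          rcases Finset.mem_union.1 hf2 with h | h
          · -- `f` enters `Q`, so its tail is `y ∈ Z`: impossible
            have hfy : f.1 = y := hin_tail f ((hmem_in Q f).2 ⟨hfarc, hf1.1, h⟩)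
            exact absurd (hfy ▸ hyZ) hf1.2
          · exact h
        have hcard := Finset.card_le_card hsub'
        rw [Finset.card_erase_of_mem he, hZin] at hcard
        have h2 := htwo (Q ∪ Z) ⟨b, Finset.mem_union_left _ hbQ⟩ hunion_ne
        omega
      -- hence `Q ∩ Z` is entered only by the two out-arcs of `y`
      have hsubQZ : inA (Q ∩ Z) ⊆ (Finset.univ.filter fun c => IsArc G y c).map
          ⟨fun c => (y, c), fun c c' h => (Prod.ext_iff.1 h).2⟩ := by
        intro f hf
        obtain ⟨hfarc, hf1, hf2⟩ := (hmem_in (Q ∩ Z) f).1 hf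
        obtain ⟨hfQ, hfZ⟩ := Finset.mem_inter.1 hf2
        rw [Finset.mem_inter, not_and_or] at hf1
        have hfy : f.1 = y := by
          rcases hf1 with h | h
          · exact hin_tail f ((hmem_in Q f).2 ⟨hfarc, h, hfQ⟩)
          · by_contra hne
            -- `f` enters `Z` with tail in `Q`
            have hf1Q : f.1 ∈ Q := hQcl f.1 f.2 hfQ hfarc hne
            exact htailZ f ((hmem_in Z f).2 ⟨hfarc, h, hfZ⟩) hf1Q
        refine Finset.mem_map.2 ⟨f.2, Finset.mem_filter.2 ⟨Finset.mem_univ _, ?_⟩, ?_⟩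
        · rw [← hfy]; exact hfarc
        · simp only [Function.Embedding.coeFn_mk]; rw [← hfy]
      have hQZin : (inA (Q ∩ Z)).card = 2 := by
        apply le_antisymm
        · exact (Finset.card_le_card hsubQZ).trans (hout_pairs y).le
        · exact htwo (Q ∩ Z) hQZne fun h => hyQ (Finset.mem_inter.1 (h ▸ Finset.mem_univ y)).1
      have hQZfam : Q ∩ Z ∈ fam :=
        (hfam_mem _).2 ⟨hQZ2, fun h => hyQ (Finset.mem_inter.1 (h ▸ Finset.mem_univ y)).1, hQZin⟩
      have hlt : (Q ∩ Z).card < Z.card :=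
        Finset.card_lt_card ⟨Finset.inter_subset_right, fun h => hyQ (Finset.mem_inter.1 (h hyZ)).1⟩
      exact absurd (hZmin _ hQZfam) (not_le.2 hlt)

end Literature.Combinatorics.SimpleGraph
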